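import Summits.Ventures.YMGap.Census.Decimation
import Literature.MathematicalPhysics.QuantumFieldTheory.VortexTwistCohomology
import HarnessLib

/-!
# Venture YMGap, track (b) — exact integration of the windows IN THE PRESENCE OF FLUX
# (Tomboulis, arXiv:0707.2179, §4.2 / App. A §4: the decimation cell with one twisted fine plaquette)

HONEST FRAMING: venture file of the cell `pub-ymgap` (QuantumFields programme), track (b); exact identities on the finite tori
`(ℤ/bLℤ)^d → (ℤ/Lℤ)^d`; nothing about (5.15), limits, confinement or a mass gap.

`WindowIntegration` integrates every `b × b` window of fine plaquettes exactly (Migdal).  Here a set `Vc` of coarse plaquettes is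
flagged; the window of a flagged `P` is integrated with its corner link `h_{0,0}` FLIPPED (`U ↦ (-𝟙)·U`, `flipAt`): the flagged window
product `tWindowProd` is the plain one read at the flipped configuration, and so is the flagged merged face `tMergedFace`.  Since the
flip is a measure-preserving involution touching no interior link, the plain exact identity `integral_windowProd_mul` transfers by
conjugation (`integral_tWindowProd_mul`), and the window-by-window induction of `WindowIntegration` goes through verbatim
(`integral_prod_tWindowProd_eq_prod_tMergedFace`).  `DecimationTwist` identifies the flagged objects with the twisted plaquette
functions `f(-U)` of `Z⁻`.
-/

noncomputable section

open MeasureTheory Finset Real Function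
open scoped BigOperators
open Literature.MathematicalPhysics.QuantumLattice
open Literature.MathematicalPhysics.QuantumFieldTheory
open Literature.MathematicalPhysics.QuantumFieldTheory.Tomboulis2007
open Summit.Ventures.LatticeQCDFlow.Exactness
open Summit.Ventures.LatticeQCDFlow.Scoring

namespace Summit.Ventures.YMGap.Census

variable {d L : ℕ} (b : ℕ)

/-- **The corner flip of the window of `P`**: the link `h_{0,0}` is multiplied by `-𝟙`. -/
def flipAt (P : Plaquette d L) (W : GaugeConfig d (b * L) SU2) : GaugeConfig d (b * L) SU2 :=
  update W (hLink b P 0 0) (negOne * W (hLink b P 0 0))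

/-- The flagged window product: the plain one at the flipped configuration when `P ∈ Vc`. -/
def tWindowProd (K : ℕ) (A : ℕ → ℝ) (Vc : Finset (Plaquette d L)) (P : Plaquette d L) (W : GaugeConfig d (b * L) SU2) : ℝ :=
  if P ∈ Vc then windowProd b K A P (flipAt b P W) else windowProd b K A P W

/-- The flagged merged face: the plain one at the flipped configuration when `P ∈ Vc`. -/
def tMergedFace (K : ℕ) (A : ℕ → ℝ) (Vc : Finset (Plaquette d L)) (P : Plaquette d L) (W : GaugeConfig d (b * L) SU2) : ℝ :=
  if P ∈ Vc then mergedFace b K A P (flipAt b P W) else mergedFace b K A P W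

variable {b}
variable [NeZero b] [NeZero L]

/-! ### The flip: an involutive, measure-preserving, continuous change of one variable -/

omit [NeZero b] [NeZero L] in
/-- The corner flip is Tomboulis's change of variables `U_b ↦ -U_b` on the single bond `h_{0,0}`. -/
theorem flipAt_eq_flipLinks (P : Plaquette d L) (W : GaugeConfig d (b * L) SU2) : flipAt b P W = flipLinks {hLink b P 0 0} W := by
  funext e
  unfold flipAt flipLinks linkSign
  by_cases h : e = hLink b P 0 0
  · subst h; simp
  · rw [update_of_ne h, if_neg (by simpa using h), one_mul]

/-- The flip is an involution. -/
theorem flipAt_flipAt (P : Plaquette d L) (W : GaugeConfig d (b * L) SU2) : flipAt b P (flipAt b P W) = W := by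
  rw [flipAt_eq_flipLinks, flipAt_eq_flipLinks]
  exact (flipEquiv {hLink b P 0 0}).symm_apply_apply W

/-- The flip preserves the product Haar measure. -/
theorem integral_comp_flipAt (P : Plaquette d L) (F : GaugeConfig d (b * L) SU2 → ℝ) :
    ∫ W, F (flipAt b P W) ∂(Measure.pi fun _ : Edge d (b * L) => haarProbability SU2) =
      ∫ W, F W ∂(Measure.pi fun _ : Edge d (b * L) => haarProbability SU2) := by
  have hmp : MeasurePreserving (flipEquiv {hLink b P 0 0}) (Measure.pi fun _ : Edge d (b * L) => haarProbability SU2)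
      (Measure.pi fun _ : Edge d (b * L) => haarProbability SU2) := measurePreserving_flipLinks _
  rw [← hmp.integral_comp' F]
  refine integral_congr_ae (ae_of_all _ fun W => ?_)
  change F (flipAt b P W) = F (flipLinks {hLink b P 0 0} W)
  rw [flipAt_eq_flipLinks]

omit [NeZero b] [NeZero L] in
/-- The flip is continuous. -/
theorem continuous_flipAt (P : Plaquette d L) : Continuous (flipAt (b := b) P) := by
  unfold flipAt
  refine continuous_pi fun e => ?_
  by_cases h : e = hLink b P 0 0
  · subst h
    simp only [update_self]
    exact continuous_const.mul (continuous_apply _)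
  · simp only [update_of_ne h]
    exact continuous_apply e

omit [NeZero b] [NeZero L] in
/-- The flip commutes with updates at other links, up to the value written. -/
theorem flipAt_update_of_ne (P : Plaquette d L) {E : Edge d (b * L)} (hE : E ≠ hLink b P 0 0) (W : GaugeConfig d (b * L) SU2)
    (g : SU2) : flipAt b P (update W E g) = update (flipAt b P W) E g := by
  unfold flipAt
  rw [update_of_ne hE.symm, update_comm hE]

omit [NeZero b] [NeZero L] in
/-- The flip commutes with updates at its own link, up to the value written. -/
theorem flipAt_update_self (P : Plaquette d L) (W : GaugeConfig d (b * L) SU2) (g : SU2) :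
    flipAt b P (update W (hLink b P 0 0) g) = update (flipAt b P W) (hLink b P 0 0) (negOne * g) := by
  unfold flipAt
  rw [update_self, update_idem, update_idem]

omit [NeZero b] [NeZero L] in
/-- A function invariant under all updates at `E` stays so after composing with the flip. -/
theorem comp_flipAt_update (P : Plaquette d L) {Q : GaugeConfig d (b * L) SU2 → ℝ} {E : Edge d (b * L)}
    (hQ : ∀ W g, Q (update W E g) = Q W) (W : GaugeConfig d (b * L) SU2) (g : SU2) :
    Q (flipAt b P (update W E g)) = Q (flipAt b P W) := by
  by_cases hE : E = hLink b P 0 0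
  · subst hE; rw [flipAt_update_self, hQ]
  · rw [flipAt_update_of_ne P hE, hQ]

/-! ### Conjugating the plain exact identity -/

/-- **The flagged window integrates exactly**: `∫ tWindowProd_P · Q = ∫ tMergedFace_P · Q` for every spectator `Q` that does not
read the interior links of the window of `P` (conjugation of `integral_windowProd_mul` by the corner flip when `P` is flagged). -/
theorem integral_tWindowProd_mul (K : ℕ) (A : ℕ → ℝ) (Vc : Finset (Plaquette d L)) (P : Plaquette d L)
    {Q : GaugeConfig d (b * L) SU2 → ℝ}
    (hQv : ∀ k t, 1 ≤ k → k < b → t < b → ∀ W g, Q (update W (vLink b P k t) g) = Q W)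
    (hQh : ∀ s k, s < b → 1 ≤ k → k < b → ∀ W g, Q (update W (hLink b P s k) g) = Q W) (hQc : Continuous Q) :
    ∫ W, tWindowProd b K A Vc P W * Q W ∂(Measure.pi fun _ : Edge d (b * L) => haarProbability SU2) =
      ∫ W, tMergedFace b K A Vc P W * Q W ∂(Measure.pi fun _ : Edge d (b * L) => haarProbability SU2) := by
  unfold tWindowProd tMergedFace
  by_cases hP : P ∈ Vc
  · simp only [if_pos hP]
    have hQ' : Continuous fun W => Q (flipAt b P W) := hQc.comp (continuous_flipAt P)
    calc ∫ W, windowProd b K A P (flipAt b P W) * Q W ∂(Measure.pi fun _ : Edge d (b * L) => haarProbability SU2)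
        = ∫ W, windowProd b K A P (flipAt b P (flipAt b P W)) * Q (flipAt b P W)
            ∂(Measure.pi fun _ : Edge d (b * L) => haarProbability SU2) :=
          (integral_comp_flipAt P fun W => windowProd b K A P (flipAt b P W) * Q W).symm
      _ = ∫ W, windowProd b K A P W * Q (flipAt b P W) ∂(Measure.pi fun _ : Edge d (b * L) => haarProbability SU2) := by
          simp_rw [flipAt_flipAt]
      _ = ∫ W, mergedFace b K A P W * Q (flipAt b P W) ∂(Measure.pi fun _ : Edge d (b * L) => haarProbability SU2) :=
          integral_windowProd_mul K A P (fun k t hk1 hkb ht W g => comp_flipAt_update P (hQv k t hk1 hkb ht) W g)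
            (fun s k hs hk1 hkb W g => comp_flipAt_update P (hQh s k hs hk1 hkb) W g) hQ'
      _ = ∫ W, mergedFace b K A P (flipAt b P (flipAt b P W)) * Q (flipAt b P W)
            ∂(Measure.pi fun _ : Edge d (b * L) => haarProbability SU2) := by simp_rw [flipAt_flipAt]
      _ = ∫ W, mergedFace b K A P (flipAt b P W) * Q W ∂(Measure.pi fun _ : Edge d (b * L) => haarProbability SU2) :=
          integral_comp_flipAt P fun W => mergedFace b K A P (flipAt b P W) * Q W
  · simp only [if_neg hP]
    exact integral_windowProd_mul K A P hQv hQh hQc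

/-! ### Continuity and update invariance of the flagged objects -/

omit [NeZero b] [NeZero L] in
/-- `tWindowProd` is continuous. -/
theorem continuous_tWindowProd (K : ℕ) (A : ℕ → ℝ) (Vc : Finset (Plaquette d L)) (P : Plaquette d L) :
    Continuous (tWindowProd b K A Vc P) := by
  unfold tWindowProd
  split_ifs
  · exact (continuous_windowProd K A P).comp (continuous_flipAt P)
  · exact continuous_windowProd K A P

omit [NeZero L] in
/-- `tMergedFace` is continuous. -/
theorem continuous_tMergedFace (K : ℕ) (A : ℕ → ℝ) (Vc : Finset (Plaquette d L)) (P : Plaquette d L) :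
    Continuous (tMergedFace b K A Vc P) := by
  unfold tMergedFace
  split_ifs
  · exact (continuous_mergedFace K A P).comp (continuous_flipAt P)
  · exact continuous_mergedFace K A P

omit [NeZero L] in
/-- The flagged merged face ignores updates at links it does not read. -/
theorem tMergedFace_update (K : ℕ) (A : ℕ → ℝ) (Vc : Finset (Plaquette d L)) (P : Plaquette d L) {E : Edge d (b * L)}
    (hh : ∀ s t', s < b → t' ≤ b → hLink b P s t' ≠ E) (hv : ∀ s' t', s' ≤ b → t' < b → vLink b P s' t' ≠ E)
    (W : GaugeConfig d (b * L) SU2) (g : SU2) : tMergedFace b K A Vc P (update W E g) = tMergedFace b K A Vc P W := by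
  unfold tMergedFace
  split_ifs
  · exact comp_flipAt_update P (fun W g => mergedFace_update K A P hh hv W g) W g
  · exact mergedFace_update K A P hh hv W g

omit [NeZero b] [NeZero L] in
/-- The flagged window product ignores updates at links it does not read. -/
theorem tWindowProd_update (K : ℕ) (A : ℕ → ℝ) (Vc : Finset (Plaquette d L)) (P : Plaquette d L) {E : Edge d (b * L)}
    (hh : ∀ s t', s < b → t' ≤ b → hLink b P s t' ≠ E) (hv : ∀ s' t', s' ≤ b → t' < b → vLink b P s' t' ≠ E)
    (W : GaugeConfig d (b * L) SU2) (g : SU2) : tWindowProd b K A Vc P (update W E g) = tWindowProd b K A Vc P W := by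
  unfold tWindowProd
  split_ifs
  · exact comp_flipAt_update P (fun W g => windowProd_update K A P hh hv W g) W g
  · exact windowProd_update K A P hh hv W g

/-! ### Processing the windows one by one -/

/-- The spectator of window `P` while the windows in `S` are merged and the others not (bookkeeping). -/
def twinSpec (K : ℕ) (A : ℕ → ℝ) (Vc S : Finset (Plaquette d L)) (P : Plaquette d L) (W : GaugeConfig d (b * L) SU2) : ℝ :=
  (∏ P' ∈ S, tMergedFace b K A Vc P' W) * ∏ P' ∈ (Finset.univ \ S).erase P, tWindowProd b K A Vc P' W

/-- `twinSpec` is continuous. -/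
theorem continuous_twinSpec (K : ℕ) (A : ℕ → ℝ) (Vc S : Finset (Plaquette d L)) (P : Plaquette d L) :
    Continuous (twinSpec (b := b) K A Vc S P) :=
  (continuous_finsetProd _ fun P' _ => continuous_tMergedFace K A Vc P').mul
    (continuous_finsetProd _ fun P' _ => continuous_tWindowProd K A Vc P')

/-- `twinSpec` does not read the interior links of the window of `P` (`P ∉ S`). -/
theorem twinSpec_update (K : ℕ) (A : ℕ → ℝ) (Vc : Finset (Plaquette d L)) {S : Finset (Plaquette d L)} {P : Plaquette d L}
    (hP : P ∉ S) {E : Edge d (b * L)}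
    (hE : (∃ k t, 1 ≤ k ∧ k < b ∧ t < b ∧ E = vLink b P k t) ∨ (∃ s k, s < b ∧ 1 ≤ k ∧ k < b ∧ E = hLink b P s k))
    (W : GaugeConfig d (b * L) SU2) (g : SU2) : twinSpec K A Vc S P (update W E g) = twinSpec K A Vc S P W := by
  have h1 : ∏ P' ∈ S, tMergedFace b K A Vc P' (update W E g) = ∏ P' ∈ S, tMergedFace b K A Vc P' W := by
    refine Finset.prod_congr rfl fun P' hP'S => ?_
    have h := interior_spec hE (P' := P') (fun h => hP (h ▸ hP'S))
    exact tMergedFace_update K A Vc P' h.1 h.2 W g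
  have h2 : ∏ P' ∈ (Finset.univ \ S).erase P, tWindowProd b K A Vc P' (update W E g) =
      ∏ P' ∈ (Finset.univ \ S).erase P, tWindowProd b K A Vc P' W := by
    refine Finset.prod_congr rfl fun P' hP' => ?_
    have h := interior_spec hE (P' := P') (Finset.mem_erase.1 hP').1
    exact tWindowProd_update K A Vc P' h.1 h.2 W g
  unfold twinSpec
  rw [h1, h2]

omit [NeZero b] in
/-- Isolating window `P` before merging it (bookkeeping). -/
theorem twinSpec_before (K : ℕ) (A : ℕ → ℝ) (Vc : Finset (Plaquette d L)) {S : Finset (Plaquette d L)} {P : Plaquette d L}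
    (hP : P ∉ S) (W : GaugeConfig d (b * L) SU2) :
    (∏ P' ∈ S, tMergedFace b K A Vc P' W) * (∏ P' ∈ Finset.univ \ S, tWindowProd b K A Vc P' W) =
      tWindowProd b K A Vc P W * twinSpec K A Vc S P W := by
  have hmem : P ∈ Finset.univ \ S := Finset.mem_sdiff.2 ⟨Finset.mem_univ _, hP⟩
  unfold twinSpec
  rw [← Finset.mul_prod_erase _ _ hmem]
  ring

omit [NeZero b] in
/-- Window `P` after merging it (bookkeeping). -/
theorem twinSpec_after (K : ℕ) (A : ℕ → ℝ) (Vc : Finset (Plaquette d L)) {S : Finset (Plaquette d L)} {P : Plaquette d L}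
    (hP : P ∉ S) (W : GaugeConfig d (b * L) SU2) :
    (∏ P' ∈ insert P S, tMergedFace b K A Vc P' W) * (∏ P' ∈ Finset.univ \ insert P S, tWindowProd b K A Vc P' W) =
      tMergedFace b K A Vc P W * twinSpec K A Vc S P W := by
  have hsd : Finset.univ \ insert P S = (Finset.univ \ S).erase P := by
    ext x
    simp only [Finset.mem_sdiff, Finset.mem_univ, true_and, Finset.mem_insert, Finset.mem_erase, not_or]
  unfold twinSpec
  rw [Finset.prod_insert hP, hsd]
  ring

/-- **All windows integrate exactly, flagged or not**: `∫ ∏_P tWindowProd_P = ∫ ∏_P tMergedFace_P` for every flag set `Vc`. -/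
theorem integral_prod_tWindowProd_eq_prod_tMergedFace (K : ℕ) (A : ℕ → ℝ) (Vc : Finset (Plaquette d L)) :
    ∫ W, ∏ P : Plaquette d L, tWindowProd b K A Vc P W ∂(Measure.pi fun _ : Edge d (b * L) => haarProbability SU2) =
      ∫ W, ∏ P : Plaquette d L, tMergedFace b K A Vc P W ∂(Measure.pi fun _ : Edge d (b * L) => haarProbability SU2) := by
  suffices h : ∀ S : Finset (Plaquette d L),
      ∫ W, ∏ P : Plaquette d L, tWindowProd b K A Vc P W ∂(Measure.pi fun _ : Edge d (b * L) => haarProbability SU2) =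
        ∫ W, (∏ P ∈ S, tMergedFace b K A Vc P W) * (∏ P ∈ Finset.univ \ S, tWindowProd b K A Vc P W)
          ∂(Measure.pi fun _ : Edge d (b * L) => haarProbability SU2) by
    rw [h Finset.univ]
    simp only [Finset.sdiff_self, Finset.prod_empty, mul_one]
  intro S
  induction S using Finset.induction_on with
  | empty =>
    simp only [Finset.prod_empty, Finset.sdiff_empty, one_mul]
  | insert P S hP ih =>
    rw [ih]
    simp_rw [twinSpec_before K A Vc hP, twinSpec_after K A Vc hP]
    refine integral_tWindowProd_mul K A Vc P ?_ ?_ (continuous_twinSpec K A Vc S P)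
    · intro k t hk1 hkb ht W g
      exact twinSpec_update K A Vc hP (Or.inl ⟨k, t, hk1, hkb, ht, rfl⟩) W g
    · intro s k hs hk1 hkb W g
      exact twinSpec_update K A Vc hP (Or.inr ⟨s, k, hs, hk1, hkb, rfl⟩) W g

end Summit.Ventures.YMGap.Census

end
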